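import Summits.HodgeConjecture.HodgeConjecture.Theorems.HCCMUnconditionalOfGenericFloorV7
import Summits.HodgeConjecture.CorCM.Hyp413.A3Liu413FaceTypes
import Summits.HodgeConjecture.HodgeConjecture.Theorems.H413CohFormsCarriers
import Mathlib.RepresentationTheory.Intertwining
import Summits.HodgeConjecture.HodgeConjecture.Theorems.F0P3StubS2HodgeTypes   -- ★ p791898 (A-p09 (g18)): the S2 closer `F0P3StubS2HodgeTypes.stubS2_holds`, consumed BY NAME below (v1.2)
import Summits.HodgeConjecture.HodgeConjecture.Theorems.F0P3StubS1Dec          -- ★ p792863 (F0P3-p01 (g0)): the S1 closer `F0P3StubS1Dec.stubS1_holds`, consumed BY NAME below (v1.3)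
import Literature.NumberTheory.Automorphic.UnitaryGroupCotangentSpectralProjectionConj   -- ★ p794879 (F0P2-p01 (g2)): `antiholCotFormSpectralProjection_of_hol` ((D)a ⇐ (D)h), v1.4 HEAD 3′
import Literature.NumberTheory.Automorphic.UnitaryGroupCohomologicalFormsConjRep          -- ★ p795136 (F0P2-p01 (g2)): `cohFinComponentUnique_antihol_of_hol` (E1′a ⇐ E1′h), `cohIsotypicLine_antihol_of_hol` ((E)a ⇐ (E)h), v1.4 HEAD 3′
import Summits.HodgeConjecture.HodgeConjecture.Theorems.F0P3HJ3aOfLetters      -- ★ p794926 (F0P3-p02 (g0)): `HJ3aOfLetters.hJ3a_of_letters` ∕ `H413_of_letters` (row III-J3a modulo EXACTLY the eight printed-citation letters), consumed BY NAME below (v1.4); transitively ★ `F0P3HJ3aAssembly` (p01), ★ `F0P3StubS4Fold` ⊇ `F0P3StubS3S4Holds` (p03), ★ `F0P3StubS5Holds` (p02)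
import Summits.HodgeConjecture.HodgeConjecture.Cruxes.H413.Lines.a3_liu413   -- the crux's REGISTRY OF RECORD (v10.2): the two OTHER floor rows' registered stubs `stub_oscillatorTriple_dictionaryExistence` ∕ `stub_admissible_occursInH1` BY NAME (zero-hypothesis head)
import HarnessLib

/-!
# FLOOR-0 PROGRAMME P3 «U3-mult» — LINE `F0-U3CohMultOne` (cohomological multiplicity one on the inner form, at the pin), skeleton v1.1

Cell hodgecm-mathlib, FLOOR 0 (D-0183; director-hodgecm-mathlib plan v1.3 §P3 (i) «the ONE scoped Rogawski-U(3) ENGINE»; main NAMING LINE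
2026-08-30T20:33:03Z); crux item H413 = stmt-HodgeConjecture-24833 (route `HCCMUnconditional`); planner F0P3-plan (g0).
HONEST LABEL: **HC_CM is proved only modulo the printed citations until rung 0 closes.**  This file is a LINE SKELETON: five registered
`sorry` stubs and a kernel-checked composition; it changes no floor and closes nothing.
EDITION v1.2 (2026-08-30T22:00Z): stub S2 `stub_S2_hodgeTypesDisjointStable` is now DISCHARGED BY NAME from ★ p791898 `Theorems/F0P3StubS2HodgeTypes.lean` (`stubS2_holds`, A-p09 (g18)); sorries 5 → 4 (S1, S3, S4, S5). No statement text changed.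
EDITION v1.3 (2026-08-30T22:35Z): stub S1 `stub_S1_hodgeMatsushimaDecAt` is now DISCHARGED BY NAME from ★ p792863 `Theorems/F0P3StubS1Dec.lean` (`stubS1_holds`, F0P3-p01 (g0); chain ★ `H413CuspCot*`∕`H413TowerConj` → ★ `F0P3TowerGlue` → ★ `H413TowerRealisation`∕`…Glue` (F0P2-p04)); sorries 4 → 3 (S3, S4, S5). No statement text changed. INTEGRATION TARGET (next edition): the sorry-free `hJ3a_of_letters : <8 class-U letters E1, E1′h, E1′a, E2′, Dh, Da, Eh, Ea> → HJ3aType` once the S3∕S4∕S5 folds are ★.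
EDITION v1.4 (2026-08-30T23:30Z): **ROW III-J3a IS A TREE THEOREM MODULO EXACTLY THE EIGHT PRINTED-CITATION LETTERS.** New HEAD 3 `hJ3a_of_letters` := ★ `HJ3aOfLetters.hJ3a_of_letters` BY NAME (★ p794926, F0P3-p02 (g0); composition ★ `F0P3HJ3aAssembly.hJ3a_of_S345` (p01) of ★ `F0P3StubS3S4Holds.stubS3_holds`∕`stubS4_holds` (p03: S3∕S4 from E1, E1′h∕a, (D)h∕a, (E)h∕a) and ★ `F0P3StubS5Fold.stubS5_holds` (p02: S5 from E2′, (D)h, (D)a); REF1 kernel cert 22:47:11Z: conclusion ≡ `HJ3aType`, axioms [propext, Classical.choice, Quot.sound]) and HEAD 4 `H413_of_letters` (the crux BY NAME from the eight letters + the two OTHER rows' registered stubs). The registered stubs S3∕S4∕S5 stay hypothesis-free `sorry` placeholders (they cannot be closed outright: their content is conditional on class-U letters, exactly as the floor row `hJ3a` is a binder of ★ `hc_cm_of_generic_floor_v7`); their DISCHARGE MODULO LETTERS is recorded in the docstrings. sorries 3 (unchanged). LETTERS (canonical order): E1 `Rogawski1990.innerFormMultiplicityLeOne` · E1′h∕a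 `Rogawski1990.cohFinComponentUnique_hol∕_antihol` · E2′ `Rogawski1990.hodgeTypeRigid` (★ p791734 `Literature/NumberTheory/Rogawski1990/CohomologicalSpectrumInnerForm.lean`) · (D)h∕a `UnitaryGroup.CotangentForms.holCotFormSpectralProjection∕antihol…` · (E)h∕a `UnitaryGroup.CotangentForms.cohIsotypicLine_hol∕_antihol` (p792838 `Literature/NumberTheory/Automorphic/UnitaryGroupCotangentSpectralProjection.lean`). FLOOR V8 (A-plan1∕director): re-type row III-J3a from the in-house binder `hJ3a` to these eight letter binders via `HJ3aOfLetters.hJ3a_of_letters`. HEAD 3′ `hJ3a_of_five_letters`: by the CONJUGATION SYMMETRY ★ p794879∕p795136 (F0P2-p01 (g2): (D)a ⇐ (D)h, E1′a ⇐ E1′h, (E)a ⇐ (E)h) the eight letters reduce to FIVE {E1, E1′h, E2′, (D)h, (E)h}.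

TARGET = the `hJ3a` binder of ★ `Theorems/HCCMUnconditionalOfGenericFloorV7.lean` ll. 76–80 VERBATIM (= the registered stub
`stub_multiplicity_le_one_printed` of `Cruxes/H413/Lines/a3_liu413.lean` v10.2 ll. 300–305; record
`Literature.NumberTheory.Automorphic.Liu2021.Prop413Data.multiplicity_le_one_printed`): for every face `(hDel, F, V, a₀, Φ, i)`, at the PIN's
datum `P = datum413 hDel F V a₀ Φ i` (★ `CorCM/Hyp413/A3Liu413FaceTypes`), if `3 ≤ n` then for every embedding `τ'` and every admissible
weight-one adèlic oscillator triple `t`, `rank_ℂ Hom_{U(V)(𝔸_{F⁺,f})}(ω_V(t), H¹_{B,τ'}(A_∞, ℂ)) ≤ 1`.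

SCOPE (audits part 1 `A-plan/F0/P3-SCOPE-AUDIT-part1.A-p15g14.md`, part 2 `F0/P3/P3-SCOPE-AUDIT-part2.F0P3g0.md`).  The pin's `H¹_{B,τ'}` is the
tower `colim_K ⊕_h H¹(P_{Γ_h}(V); ℂ)` of FULL complex `H¹` of the compact ball quotients of `U(V)`, constant in `τ'`
(`Liu2021/AppendixC/Prop413DataOfTower.lean` :134–146), so the bound is «`ω_V(t)` occurs at most once in `H^{1,0} ⊕ H^{0,1}`».  In print this is
[Liu2021, proof of Prop. 4.13, ll. 2121–2146] = Matsushima–Zucker + «`m_disc(π) = 1`» (for `n = 3`: [Rogawski1990, Thm. 14.6.4] on the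
ANISOTROPIC INNER FORM `G′ = U(V)` with §15.3 ¶1 ∕ 13.3.6 (c), NOT the quasi-split Thm. 13.3.1) + «`π_∞` is determined by `π_f ≅ ω(t)`»
([Liu2021, Lem. D.2 (2)]; on the engine side: `J⁺` and `J⁻` lie in A-packets of different `ξ_∞`, [Rogawski1990, §12.3, 13.3.5–13.3.7]).

IDEA («why this line»).  Read the bound in FUNCTION-SPACE currency over the carriers the tree already has (★ `Theorems/H413CohFormsCarriers.lean`,
shared with P4 ∕ P2): `A := holCotForms 𝔞₀` (holomorphic cotangent-weight `K_c`-invariant smooth automorphic forms on `U(V)(F⁺)\U(V)(𝔸_{F⁺})`,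
`𝔞₀ = archFactorOf F V`), `B := A.map conjFun` (their conjugates), `cohForms 𝔞₀ = A ⊔ B`, with right translation `rightRep F V` by
`U(V)(𝔸_{F⁺,f})`.  Five genuine lemmas, none of which is the target:
* S1 (Matsushima–Hodge, the INVERSE half of P4's T2): `H¹_B` embeds `G_f`-equivariantly into `cohForms 𝔞₀` — every class has harmonic
  `(1,0) ⊕ (0,1)` representatives which ARE cotangent automorphic forms, compatibly with the tower ([BorelWallach2000, VII 3.2; XIII 1.2],
  [VoisinHodgeI2002, Cor. 7.6], [Borel1997, §5.14]);
* S2 (carrier algebra): the two Hodge types are DISJOINT and each is STABLE under finite-adèlic right translation;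
* S3 ∕ S4 (E1′ «cohomological multiplicity one on `G′`», per Hodge type): the `G_f`-equivariant `A`-valued (resp. `B`-valued) linear maps
  out of `ω_V(t)` lie on ONE LINE — at most one discrete `K_c`-trivial `π` of `U(V)` of the given Hodge type has `π_f ≅ ω_V(t)`, and
  `m(π) ≤ 1` ([Rogawski1990, Thm. 14.6.4, (14.6.2), §15.3 ¶1]; junction: Matsushima on the automorphic side, [Marshall2014, §4.1]);
* S5 (E2′ «Hodge-type rigidity»): `ω_V(t)` does not map equivariantly and non-trivially into BOTH `A` and `B` ([Rogawski1990, §12.3 with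
  13.3.5–13.3.7]: `J^±` sit in A-packets of different `ξ_∞` and `π_f` determines `ξ`; [Liu2021, Lem. D.2 (2)]).
COMPOSITION (kernel-checked below, generic linear algebra `rank_intertwiningMap_le_one_of_split`): post-composition with S1's `dec` embeds
`Hom_{G_f}(ω_V(t), H¹_B)` into the equivariant `(A ⊔ B)`-valued maps; S2 splits such a map uniquely into equivariant `A`- and `B`-components;
S5 kills one component, S3 ∕ S4 put the other on a line; hence `rank ≤ 1`.

STRATEGY ∕ DISCHARGERS.  S1: the B4 desk's Matsushima–Hodge theorem («P4's `cls : cohForms 𝔞₀ → H¹_B` is bijective»; one theorem serves T2 and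
S1).  S2: from the definitions of the carriers (weight-type bookkeeping; A-p13's `H413CohFormsCarriersLemmas`).  S3 ∕ S4 ∕ S5: the typer's
THETA-FREE Literature letters E1′ `CohMultiplicityLeOne` ∕ E2′ `HodgeTypeRigid` over `UnitaryGroup.cmDatum L 3 H` + `DiscreteAutomorphicRep`
(`Literature/NumberTheory/Rogawski1990/CohomologicalSpectrumInnerForm.lean`, F0-typ1), folded through the automorphic junction J («equivariant
`σ → holCotForms 𝔞₀` maps inject into `⊕_Π Hom(σ, Π_f)^{m(Π)}` over discrete `Π` of type (1,0)», shared with P2's U2ℓ ∕ U2a cut through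
`L²(U(V)(F⁺)\U(V)(𝔸_{F⁺}))`); the letters are what rung 0's ENGINE (scope audit part 2 §3, T1–T7: anisotropic trace formula + stabilisation,
e.v.p. separation, local A-packets, 13.3.6 (c) on `G′`, archimedean `H¹`, the count in 14.6.4) eventually proves.  NOT used on this line: E2 ∕ E2b
∕ E3 (P2's), any theta dictionary, Rallis ∕ [Li1992], [GelbartRogawski1991], [Rogawski1992] (the parity erratum touches E3 only).

MATHLIB REUSE MAP.  `Representation`, `Representation.IntertwiningMap` (+ `toLinearMapl`, `isIntertwining`, `ext`), `Submodule` lattice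
(`⊔`, `map` along the semilinear `conjFun`, `Disjoint`, `disjoint_def`, `mem_span_singleton`), `LinearMap.coprod ∕ codRestrict ∕ llcomp`,
`LinearEquiv.ofInjective`, `LinearMap.rank_le_of_injective`, `rank_span_le`; number-field side entirely through the tree's carriers
(`NumberField.AdeleRing` under `UnitaryGroup.adelicGroupData`).  NEW Mathlib-level content needed by the dischargers: none for S2 and the
composition; S1 needs Hodge theory on compact Kähler manifolds (tree: `HodgeCM.Universe`, ★ `F¹H¹`, `classMapDatumOf`); S3–S5 need the
automorphic spectrum of compact quotients (tree ★ `AutomorphicSpectrum`, `AdelicUnitaryGroupSpectrum`).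

HEADS.  `multiplicity_le_one_printed_holds_of : S1 → S2 → S3 → S4 → S5 → HJ3aType` (the `_holds` composition; `HJ3aType` = the floor binder's
type verbatim), `hJ3a_of_stubs : HJ3aType` (zero hypotheses beyond the five stubs; the by-name fold target of the registry's
`stub_multiplicity_le_one_printed`, whose type IS `HJ3aType` — kernel `example` below), and the head of record `H413_of_P3 : HCCMUnconditional.H413`
with ZERO hypotheses `:= ★ Hyp413Closing.H413_of_three_facts_flat A3Liu413.stub_oscillatorTriple_dictionaryExistence hJ3a_of_stubs
A3Liu413.stub_admissible_occursInH1` — the two OTHER floor rows enter through the REGISTERED stubs of the crux's registry of record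
`Cruxes/H413/Lines/a3_liu413.lean` v10.2 (:271 ∕ :310; programmes P2 ∕ P4 fold into them by name), NOT re-declared here (no duplicate obligations) and
NOT taken as free hypotheses (so the skeleton audit has no `skeleton.extra-hypothesis`); kernel `example`s certify that those two registered stubs have
exactly the floor binder types `HdictEType` ∕ `HoccType`.  The fully hypothetical form is the term `H413_of_three_facts_flat hdictE
(multiplicity_le_one_printed_holds_of h1 h2 h3 h4 h5) hocc` (v1 of this file, `H413_of_P3` with seven hypotheses).
-/

-- the mandated namespace has the single-problem summit's repeated segment (`HodgeConjecture.HodgeConjecture`), as in every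
-- `Cruxes/…/Lines/*.lean` and `Theorems/*.lean` of this sub-problem
set_option linter.dupNamespace false

noncomputable section

namespace Summit.HodgeConjecture.HodgeConjecture.Cruxes.H413.F0U3CohMultOne

open scoped TensorProduct Matrix
open NumberField NumberField.InfinitePlace IsDedekindDomain
open HodgeCM.Model HodgeCM.Model.LiuIndex HodgeCM.Model.TowerCarrier
open Summit.HodgeConjecture.CorCM.Model
open Literature.AlgebraicGeometry.Motives (CMType AbelianVariety)
open Literature.AlgebraicGeometry.HodgeTheory Literature.NumberTheory.Automorphic.PicardCM
open Literature.AlgebraicGeometry.ShimuraVarieties Literature.AlgebraicGeometry.ShimuraVarieties.UnitaryCanonicalModel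
open Literature.NumberTheory.ComplexMultiplication
open Literature.NumberTheory.Automorphic
open Literature.NumberTheory.Automorphic.Liu2021 Literature.NumberTheory.Automorphic.Liu2021.AppendixC
open Literature.NumberTheory.Automorphic.Liu2021.Def411WeilCarriers (lineOf locF Rep)
open Summit.HodgeConjecture.CorCM.Transposition.OmegaTransport (realUnit)
open HodgeCM.Model.ArchSideTerm (e₁)
open Literature.NumberTheory.GelbartRogawski1991 Literature.NumberTheory.GelbartRogawski1991.UnitaryDualPair
open Literature.RepresentationTheory Literature.RepresentationTheory.Liu2021
open Summit.HodgeConjecture.CorCM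
open Summit.HodgeConjecture.CorCM.Transposition
open Literature.NumberTheory.GelbartRogawski1991.OscillatorTripleDictionary (OccursInH1 IsIsoToOmega)
open Summit.HodgeConjecture.CorCM.Lines.A3Liu418 (Thm415AtFace EpsRigidAtFace)
open Summit.HodgeConjecture.HodgeConjecture.Theses (HCCMUnconditional.HDel)
open MulAction
open Literature.Geometry.ComplexHyperbolic.BallModel (U21 x₀)
open Literature.NumberTheory.GelbartRogawski1991.OscillatorTripleDictionary (rhoTriple)
open Summit.HodgeConjecture.CorCM.Lines.A3Liu413 (datum413)

/-! ## §0 The three binder types of the floor, VERBATIM (floor V7 ll. 71–85; same text as P4's skeleton `P4AdmissibleOccursInH1` §0) -/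

set_option synthInstance.maxHeartbeats 400000 in
set_option maxHeartbeats 8000000 in
/-- **`HJ3aType`** — the TYPE of the `hJ3a` binder of ★ `hc_cm_of_generic_floor_v7` (ll. 76–80), row III-J3a (multiplicity `≤ 1`), VERBATIM;
THIS programme's target. [cite: Liu2021, proof of Prop. 4.13, l. 2145] [cite: Rogawski1990, Thm. 14.6.4; §15.3] -/
def HJ3aType : Prop :=
  ∀ (hDel : Literature.AlgebraicGeometry.ShimuraVarieties.UnitaryCanonicalModel.canonicalModel_exists_printed)
    (F : HodgeCM.CMField) [IsGalois ℚ F] (h6 : 6 ≤ Module.finrank ℚ F) {ι₁ : F →+* ℂ} (V : HodgeCM.HermSpace3 F ι₁) (a₀ : RealScalar F)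
    (Φ : CMType F) (hΦ : ι₁ ∈ Φ.1) (i : (I V (repAt a₀) (muLiu ι₁ GramClass.rep))),
    (((uniformOmegaRep (Summit.HodgeConjecture.CorCM.DelRec.exists_recordSystem_of_printed hDel) ⟨HodgeCM.CMField.K F⟩ ι₁ ⟨HodgeCM.HermSpace3.Hm V, HodgeCM.HermSpace3.isHermitian V, HodgeCM.HermSpace3.signature_ι₁ V, HodgeCM.HermSpace3.posDef_of_ne V⟩ Φ e₁ (frameD V) (frameD_real V) (frameD_ne V) (ιVE V) (2 * imagUnit (HodgeCM.CMField.K F))⁻¹ (fun _ _ => (Rep.update ↥(maximalRealSubfield (HodgeCM.CMField.K F)) (imagUnitSq (HodgeCM.CMField.K F)) (Rep.ofLineOf ↥(maximalRealSubfield (HodgeCM.CMField.K F)) (imagUnitSq (HodgeCM.CMField.K F))) (locF ↥(maximalRealSubfield (HodgeCM.CMField.K F)) (imagUnitSq (HodgeCM.CMField.K F)) (realUnit ⟨HodgeCM.CMField.K F⟩ (repAt a₀ (Sigma.fst i)).1 (repAt a₀ (Sigma.fst i)).2.1 (repAt a₀ (Sigma.fst i)).2.2)) (realUnit ⟨HodgeCM.CMField.K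 F⟩ (repAt a₀ (Sigma.fst i)).1 (repAt a₀ (Sigma.fst i)).2.1 (repAt a₀ (Sigma.fst i)).2.2) rfl)))).prop413Data ((liuDictionaryPin exists_isReal_hodgeModel_holds hodgePQ_independent_of_hodgeModel_holds BallQuotient.ballQuotientUniformised_holds (cmAbelianVarietyRealised_of_eigenbasis exists_isReal_hodgeModel_holds hodgePQ_independent_of_hodgeModel_holds cmAbelianVarietyEigenbasisRealised_holds) Literature.NumberTheory.Transcendental.arapura2012_cor_15_4_6_holds V (I V (repAt a₀) (muLiu ι₁ GramClass.rep)) (line V (repAt a₀) (muLiu ι₁ GramClass.rep)))).H).multiplicity_le_one_printed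

set_option synthInstance.maxHeartbeats 400000 in
set_option maxHeartbeats 8000000 in
/-- **`HdictEType`** — the TYPE of the `hdictE` binder of ★ `hc_cm_of_generic_floor_v7` (ll. 71–75), row III-2 (a)′ (existence half of the
oscillator-triple dictionary), VERBATIM; programme P2's target, an INPUT of the crux head only. [cite: Liu2021, proof of Prop. 4.13, l. 2145]
[cite: GelbartRogawski1991, Introduction p. 448; Thm 5.1.1 p. 465] -/
def HdictEType : Prop :=
  ∀ (hDel : Literature.AlgebraicGeometry.ShimuraVarieties.UnitaryCanonicalModel.canonicalModel_exists_printed)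
    (F : HodgeCM.CMField) [IsGalois ℚ F] (h6 : 6 ≤ Module.finrank ℚ F) {ι₁ : F →+* ℂ} (V : HodgeCM.HermSpace3 F ι₁) (a₀ : RealScalar F)
    (Φ : CMType F) (hΦ : ι₁ ∈ Φ.1) (i : (I V (repAt a₀) (muLiu ι₁ GramClass.rep))),
    oscillatorTriple_dictionaryExistence (((uniformOmegaRep (Summit.HodgeConjecture.CorCM.DelRec.exists_recordSystem_of_printed hDel) ⟨HodgeCM.CMField.K F⟩ ι₁ ⟨HodgeCM.HermSpace3.Hm V, HodgeCM.HermSpace3.isHermitian V, HodgeCM.HermSpace3.signature_ι₁ V, HodgeCM.HermSpace3.posDef_of_ne V⟩ Φ e₁ (frameD V) (frameD_real V) (frameD_ne V) (ιVE V) (2 * imagUnit (HodgeCM.CMField.K F))⁻¹ (fun _ _ => (Rep.update ↥(maximalRealSubfield (HodgeCM.CMField.K F)) (imagUnitSq (HodgeCM.CMField.K F)) (Rep.ofLineOf ↥(maximalRealSubfield (HodgeCM.CMField.K F)) (imagUnitSq (HodgeCM.CMField.K F))) (locF ↥(maximalRealSubfield (HodgeCM.CMField.K F)) (imagUnitSq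 (HodgeCM.CMField.K F)) (realUnit ⟨HodgeCM.CMField.K F⟩ (repAt a₀ (Sigma.fst i)).1 (repAt a₀ (Sigma.fst i)).2.1 (repAt a₀ (Sigma.fst i)).2.2)) (realUnit ⟨HodgeCM.CMField.K F⟩ (repAt a₀ (Sigma.fst i)).1 (repAt a₀ (Sigma.fst i)).2.1 (repAt a₀ (Sigma.fst i)).2.2) rfl)))).prop413Data ((liuDictionaryPin exists_isReal_hodgeModel_holds hodgePQ_independent_of_hodgeModel_holds BallQuotient.ballQuotientUniformised_holds (cmAbelianVarietyRealised_of_eigenbasis exists_isReal_hodgeModel_holds hodgePQ_independent_of_hodgeModel_holds cmAbelianVarietyEigenbasisRealised_holds) Literature.NumberTheory.Transcendental.arapura2012_cor_15_4_6_holds V (I V (repAt a₀) (muLiu ι₁ GramClass.rep)) (line V (repAt a₀) (muLiu ι₁ GramClass.rep)))).H)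

set_option synthInstance.maxHeartbeats 400000 in
set_option maxHeartbeats 8000000 in
/-- **`HoccType`** — the TYPE of the `hocc` binder of ★ `hc_cm_of_generic_floor_v7` (ll. 81–85), row III-2 (c)′ (occurrence), VERBATIM;
programme P4's target, an INPUT of the crux head only. [cite: Liu2021, proof of Prop. 4.13, l. 2145] [cite: Li1992, Thm. 2.1] -/
def HoccType : Prop :=
  ∀ (hDel : Literature.AlgebraicGeometry.ShimuraVarieties.UnitaryCanonicalModel.canonicalModel_exists_printed)
    (F : HodgeCM.CMField) [IsGalois ℚ F] (h6 : 6 ≤ Module.finrank ℚ F) {ι₁ : F →+* ℂ} (V : HodgeCM.HermSpace3 F ι₁) (a₀ : RealScalar F)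
    (Φ : CMType F) (hΦ : ι₁ ∈ Φ.1) (i : (I V (repAt a₀) (muLiu ι₁ GramClass.rep))),
    admissible_occursInH1 (((uniformOmegaRep (Summit.HodgeConjecture.CorCM.DelRec.exists_recordSystem_of_printed hDel) ⟨HodgeCM.CMField.K F⟩ ι₁ ⟨HodgeCM.HermSpace3.Hm V, HodgeCM.HermSpace3.isHermitian V, HodgeCM.HermSpace3.signature_ι₁ V, HodgeCM.HermSpace3.posDef_of_ne V⟩ Φ e₁ (frameD V) (frameD_real V) (frameD_ne V) (ιVE V) (2 * imagUnit (HodgeCM.CMField.K F))⁻¹ (fun _ _ => (Rep.update ↥(maximalRealSubfield (HodgeCM.CMField.K F)) (imagUnitSq (HodgeCM.CMField.K F)) (Rep.ofLineOf ↥(maximalRealSubfield (HodgeCM.CMField.K F)) (imagUnitSq (HodgeCM.CMField.K F))) (locF ↥(maximalRealSubfield (HodgeCM.CMField.K F)) (imagUnitSq (HodgeCM.CMField.K F)) (realUnit ⟨HodgeCM.CMField.K F⟩ (repAt a₀ (Sigma.fst i)).1 (repAt a₀ (Sigma.fst i)).2.1 (repAt a₀ (Sigma.fst i)).2.2)) (realUnit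 ⟨HodgeCM.CMField.K F⟩ (repAt a₀ (Sigma.fst i)).1 (repAt a₀ (Sigma.fst i)).2.1 (repAt a₀ (Sigma.fst i)).2.2) rfl)))).prop413Data ((liuDictionaryPin exists_isReal_hodgeModel_holds hodgePQ_independent_of_hodgeModel_holds BallQuotient.ballQuotientUniformised_holds (cmAbelianVarietyRealised_of_eigenbasis exists_isReal_hodgeModel_holds hodgePQ_independent_of_hodgeModel_holds cmAbelianVarietyEigenbasisRealised_holds) Literature.NumberTheory.Transcendental.arapura2012_cor_15_4_6_holds V (I V (repAt a₀) (muLiu ι₁ GramClass.rep)) (line V (repAt a₀) (muLiu ι₁ GramClass.rep)))).H)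

/-! ## §1 The carriers — IN THE TREE BY NAME: ★ `Theorems/H413CohFormsCarriers.lean` (p787557; shared with P4 ∕ P2)
`adelicDatum F V` (`U(V)` as an adelic group datum over `F⁺`), `rightRep F V` (right translation of functions `U(V)(𝔸_{F⁺}) → ℂ²` by
`U(V)(𝔸_{F⁺,f}) = ↥V.adelicFin = (datum413 …).G`), `conjFun F V`, `holCotForms 𝔞`, `cohForms 𝔞 := holCotForms 𝔞 ⊔ (holCotForms 𝔞).map conjFun`,
`archFactorOf F V` (the archimedean factor of record, HONEST by ★ `P4StubT1ArchFactor.archFactorOf_isHonest`). -/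

open Summit.HodgeConjecture.HodgeConjecture.Cruxes.H413.CohFormsCarriers

/-! ## §2 The five registered P3 stubs (statements over existing declarations only) -/

set_option synthInstance.maxHeartbeats 400000 in
set_option maxHeartbeats 8000000 in
/-- STUB TYPE **S1 — MATSUSHIMA–HODGE REALISATION OF CLASSES BY COTANGENT FORMS, AT THE PIN** (M–L; B4 desk; the INVERSE half of P4's
`StubT2MatsushimaHodgeAt`): for every face, if `3 ≤ n`, for every `τ'` there is an INJECTIVE `ℂ`-linear map
`dec : H¹_{B,τ'}(A_∞, ℂ) → (U(V)(𝔸_{F⁺}) → ℂ²)` out of the PIN's tower module, `U(V)(𝔸_{F⁺,f})`-EQUIVARIANT for the Hecke action `rhoB τ'` and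
right translation `rightRep`, with values in the cohomological cotangent forms `cohForms 𝔞₀ = holCotForms 𝔞₀ ⊔ conj(holCotForms 𝔞₀)` at the factor of
record `𝔞₀ = archFactorOf F V`.  Content: on each compact Kähler surface `P_Γ(V) = Γ\𝔹²` every class in `H¹(P_Γ; ℂ)` has a unique harmonic
representative, of type `(1,0) ⊕ (0,1)`, i.e. a holomorphic 1-form plus the conjugate of one ([VoisinHodgeI2002, Cor. 7.6, Thm. 6.32]); a
holomorphic 1-form of level `Γ.K` IS a holomorphic cotangent-weight automorphic form ([Borel1997, §5.14]; ★ `Model.classMapDatumOf`); the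
assignment is compatible with pull-back in the tower and with Hecke translation ([BorelWallach2000, VII 3.2, 3.6; XIII 1.2]), hence assembles on
`H = colim_K ⊕_h H¹(P_{Γ_h}; ℂ)` (`LiuDictionary` (α4)).  Together with P4's T2 (`cls : cohForms 𝔞₀ → H¹_B` injective equivariant) this is ONE desk
theorem «`cls` is a `G_f`-equivariant isomorphism», `dec = cls⁻¹`.  Why it might fail: only by an object mismatch between the tower `H` (identity
components `P_Γ`) and forms on all of `U(V)(F⁺)\U(V)(𝔸)` — forms supported on one double coset still lie in `cohForms 𝔞₀`, so injectivity and
equivariance survive (reshaping, not failure). [cite: BorelWallach2000, VII 3.2, VII 3.6, XIII 1.2] [cite: VoisinHodgeI2002, Cor. 7.6]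
[cite: Borel1997, §5.14] [cite: Liu2021, proof of Prop. 4.13, l. 2121–2131] -/
def StubS1HodgeMatsushimaDecAt : Prop :=
  ∀ (hDel : Literature.AlgebraicGeometry.ShimuraVarieties.UnitaryCanonicalModel.canonicalModel_exists_printed)
      (F : HodgeCM.CMField) [IsGalois ℚ F] (h6 : 6 ≤ Module.finrank ℚ F) {ι₁ : F →+* ℂ} (V : HodgeCM.HermSpace3 F ι₁) (a₀ : RealScalar F)
      (Φ : CMType F) (hΦ : ι₁ ∈ Φ.1) (i : (I V (repAt a₀) (muLiu ι₁ GramClass.rep))),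
      3 ≤ (datum413 hDel F V a₀ Φ i).n → ∀ τ' : HodgeCM.CMField.K F →+* ℂ,
        ∃ dec : (datum413 hDel F V a₀ Φ i).HB τ' →ₗ[ℂ] ((adelicDatum F V).Adelic → (Fin 2 → ℂ)),
          Function.Injective dec ∧ (∀ x, dec x ∈ cohForms (archFactorOf F V)) ∧
            ∀ (g : ↥(HodgeCM.HermSpace3.adelicFin V)) (x : (datum413 hDel F V a₀ Φ i).HB τ'),
              dec ((datum413 hDel F V a₀ Φ i).rhoB τ' g x) = rightRep F V g (dec x)

/-- STUB TYPE **S2 — THE TWO HODGE TYPES ARE DISJOINT AND HECKE-STABLE** (S; carrier algebra, from the definitions in `Theorems/H413CohFormsCarriers.lean`):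
for every `(F, V)`, at `𝔞₀ = archFactorOf F V`, `holCotForms 𝔞₀ ⊓ conj(holCotForms 𝔞₀) = ⊥` (a smooth function that is a holomorphic cotangent-weight form
and the conjugate of one has two different `K_∞`-weights unless it vanishes — weight `weightOf x₀` vs its conjugate, which differ on the circle
`stabilizer U21 x₀`), and finite-adèlic right translation `f ↦ f(· g)` preserves each type (the weight, holomorphy and `K_c`-invariance conditions are
conditions in the archimedean variable and commute with right translation by `U(V)(𝔸_{F⁺,f})`; smoothness is preserved).  Why it might fail: it
cannot for honest carriers; if `holCotForms` were `⊥` it holds vacuously (then S1 forces `H¹_B = 0`, consistent). [cite: Borel1997, §5.14]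
[cite: BorelWallach2000, VII 3.2] -/
def StubS2HodgeTypesDisjointStable : Prop :=
  ∀ (F : HodgeCM.CMField) {ι₁ : F →+* ℂ} (V : HodgeCM.HermSpace3 F ι₁),
    Disjoint (holCotForms (archFactorOf F V)) ((holCotForms (archFactorOf F V)).map (conjFun F V)) ∧
      (∀ (g : ↥(HodgeCM.HermSpace3.adelicFin V)) (f : (adelicDatum F V).Adelic → (Fin 2 → ℂ)),
          f ∈ holCotForms (archFactorOf F V) → rightRep F V g f ∈ holCotForms (archFactorOf F V)) ∧
      (∀ (g : ↥(HodgeCM.HermSpace3.adelicFin V)) (f : (adelicDatum F V).Adelic → (Fin 2 → ℂ)),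
          f ∈ (holCotForms (archFactorOf F V)).map (conjFun F V) →
            rightRep F V g f ∈ (holCotForms (archFactorOf F V)).map (conjFun F V))

set_option synthInstance.maxHeartbeats 400000 in
set_option maxHeartbeats 8000000 in
/-- STUB TYPE **S3 — THE HOLOMORPHIC LINE: `ω_V(t)` OCCURS AT MOST ONCE AMONG THE HOLOMORPHIC COTANGENT FORMS** (L; engine output E1′ at Hodge type
`(1,0)` ∘ junction J): for every face, if `3 ≤ n`, for every admissible weight-one triple `t`, the `U(V)(𝔸_{F⁺,f})`-equivariant `ℂ`-linear maps
`ψ : ω_V(t) → (U(V)(𝔸_{F⁺}) → ℂ²)` with values in `holCotForms 𝔞₀` lie on one line (`∃ ψ₀, ∀ ψ, ∃ r, ψ = r • ψ₀`).  Content: such a `ψ` lands in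
`L²_disc(U(V)(F⁺)\U(V)(𝔸_{F⁺}))` (compact quotient) inside the sum of the `π_f`-isotypic parts of the discrete `K_c`-trivial `π` with `π_{ι₁} = J⁺` (the
`(𝔤,K)`-module generated by a holomorphic cotangent-weight vector; [BorelWallach2000, VII 3.2], [Marshall2014, §4.1]); by [Rogawski1990, Thm. 14.6.4 with
(14.6.2), §15.3 ¶1 and 13.3.6 (c)] every such `π` lies in an A-packet `Π′(ξ)`, `dim ξ = 1`, determined by `π_f`, in which the member with prescribed
`π_f` and `π_{ι₁}` is unique and has `m(π) ≤ 1`; with `ω_V(t)` irreducible (★ mod row hD1″, `Item6UniformOmegaRepAdjectivesOfLemD1`) the space of such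
`ψ` is `Hom(ω_V(t), π_f)^{m(π)}`, of dimension `≤ 1`.  Discharged by the typer's letter `CohMultiplicityLeOne` (p = (1,0)) + J.  Why it might fail: NOT
by the [Rogawski1992] erratum (no sign is read); only if the junction J mis-identifies the `(𝔤,K)`-type of `holCotForms` (then re-type D2(a), not the
engine). [cite: Rogawski1990, Thm. 14.6.4, Thm. 14.6.1, §15.3] [cite: Marshall2014, §3.4, §4.1] [cite: Liu2021, proof of Prop. 4.13, l. 2131–2146; Rem. 4.14] -/
def StubS3HolLineAt : Prop :=
  ∀ (hDel : Literature.AlgebraicGeometry.ShimuraVarieties.UnitaryCanonicalModel.canonicalModel_exists_printed)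
      (F : HodgeCM.CMField) [IsGalois ℚ F] (h6 : 6 ≤ Module.finrank ℚ F) {ι₁ : F →+* ℂ} (V : HodgeCM.HermSpace3 F ι₁) (a₀ : RealScalar F)
      (Φ : CMType F) (hΦ : ι₁ ∈ Φ.1) (i : (I V (repAt a₀) (muLiu ι₁ GramClass.rep))),
      3 ≤ (datum413 hDel F V a₀ Φ i).n → ∀ t : (datum413 hDel F V a₀ Φ i).AdmTriple,
        ∃ ψ₀ : (datum413 hDel F V a₀ Φ i).omegaAt t →ₗ[ℂ] ((adelicDatum F V).Adelic → (Fin 2 → ℂ)),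
          ∀ ψ : (datum413 hDel F V a₀ Φ i).omegaAt t →ₗ[ℂ] ((adelicDatum F V).Adelic → (Fin 2 → ℂ)),
            (∀ (g : ↥(HodgeCM.HermSpace3.adelicFin V)) (w : (datum413 hDel F V a₀ Φ i).omegaAt t),
                ψ ((datum413 hDel F V a₀ Φ i).rhoAt t g w) = rightRep F V g (ψ w)) →
              (∀ w, ψ w ∈ holCotForms (archFactorOf F V)) → ∃ r : ℂ, ψ = r • ψ₀

set_option synthInstance.maxHeartbeats 400000 in
set_option maxHeartbeats 8000000 in
/-- STUB TYPE **S4 — THE ANTI-HOLOMORPHIC LINE** (L; engine output E1′ at Hodge type `(0,1)` ∘ J): the same as S3 with values in the conjugate forms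
`(holCotForms 𝔞₀).map conjFun` (`π_{ι₁} = J⁻`).  Discharged by `CohMultiplicityLeOne` (p = (0,1)) + J.  Why it might fail: as S3.
[cite: Rogawski1990, Thm. 14.6.4, Thm. 14.6.1, §15.3] [cite: Marshall2014, §3.4, §4.1] [cite: Liu2021, proof of Prop. 4.13, l. 2131–2146] -/
def StubS4AntiholLineAt : Prop :=
  ∀ (hDel : Literature.AlgebraicGeometry.ShimuraVarieties.UnitaryCanonicalModel.canonicalModel_exists_printed)
      (F : HodgeCM.CMField) [IsGalois ℚ F] (h6 : 6 ≤ Module.finrank ℚ F) {ι₁ : F →+* ℂ} (V : HodgeCM.HermSpace3 F ι₁) (a₀ : RealScalar F)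
      (Φ : CMType F) (hΦ : ι₁ ∈ Φ.1) (i : (I V (repAt a₀) (muLiu ι₁ GramClass.rep))),
      3 ≤ (datum413 hDel F V a₀ Φ i).n → ∀ t : (datum413 hDel F V a₀ Φ i).AdmTriple,
        ∃ ψ₀ : (datum413 hDel F V a₀ Φ i).omegaAt t →ₗ[ℂ] ((adelicDatum F V).Adelic → (Fin 2 → ℂ)),
          ∀ ψ : (datum413 hDel F V a₀ Φ i).omegaAt t →ₗ[ℂ] ((adelicDatum F V).Adelic → (Fin 2 → ℂ)),
            (∀ (g : ↥(HodgeCM.HermSpace3.adelicFin V)) (w : (datum413 hDel F V a₀ Φ i).omegaAt t),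
                ψ ((datum413 hDel F V a₀ Φ i).rhoAt t g w) = rightRep F V g (ψ w)) →
              (∀ w, ψ w ∈ (holCotForms (archFactorOf F V)).map (conjFun F V)) → ∃ r : ℂ, ψ = r • ψ₀

set_option synthInstance.maxHeartbeats 400000 in
set_option maxHeartbeats 8000000 in
/-- STUB TYPE **S5 — HODGE-TYPE RIGIDITY: `ω_V(t)` DOES NOT OCCUR WITH BOTH HODGE TYPES** (M; engine output E2′ ∘ J, SIGN-FREE): for every face, if `3 ≤ n`,
for every admissible weight-one `t`, EITHER every equivariant `holCotForms 𝔞₀`-valued linear map out of `ω_V(t)` vanishes OR every equivariant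
`conj(holCotForms 𝔞₀)`-valued one does.  Content: a discrete `π` with `π_{ι₁} = J⁺ = π^n(ξ(b,a,c))` and one with `π′_{ι₁} = J⁻ = π^n(ξ(a,c,b))` lie in
A-packets `Π′(ξ)`, `Π′(ξ′)` ([Rogawski1990, §12.3; 13.3.6 (c) via §15.3 ¶1]); `π_f ≅ π′_f ≅ ω_V(t)` forces `t(π) = t(π′)`, hence `ξ = ξ′` (13.3.5, 13.3.7: `ξ` is
determined by almost all `ξ_v`), hence `ξ_∞ = ξ′_∞` — impossible.  Liu's form: `π_∞` is DETERMINED by `π_f ≅ ω(μ,ε,χ)` (Case 1 of the proof; Lem. D.2 (2):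
the archimedean theta component has one Hodge type).  The SIGNED rule (which type, from `i⁻¹τ₁⁺(e)`) is P2-U4's, not used here.  Discharged by the typer's
letter `HodgeTypeRigid` + J.  Why it might fail: not from sign conventions (none is read); only if two different one-dimensional `ξ ≠ ξ′` could share all
finite components of a packet member (excluded by 13.3.5 ∕ strong multiplicity one for Hecke characters). [cite: Rogawski1990, §12.3, Thm. 13.3.5, Thm. 13.3.7,
Prop. 15.2.1] [cite: Marshall2014, §3.3] [cite: Liu2021, proof of Prop. 4.13, l. 2140–2146; Lem. D.2 (2)] -/
def StubS5HodgeTypeExclusionAt : Prop :=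
  ∀ (hDel : Literature.AlgebraicGeometry.ShimuraVarieties.UnitaryCanonicalModel.canonicalModel_exists_printed)
      (F : HodgeCM.CMField) [IsGalois ℚ F] (h6 : 6 ≤ Module.finrank ℚ F) {ι₁ : F →+* ℂ} (V : HodgeCM.HermSpace3 F ι₁) (a₀ : RealScalar F)
      (Φ : CMType F) (hΦ : ι₁ ∈ Φ.1) (i : (I V (repAt a₀) (muLiu ι₁ GramClass.rep))),
      3 ≤ (datum413 hDel F V a₀ Φ i).n → ∀ t : (datum413 hDel F V a₀ Φ i).AdmTriple,
        (∀ ψ : (datum413 hDel F V a₀ Φ i).omegaAt t →ₗ[ℂ] ((adelicDatum F V).Adelic → (Fin 2 → ℂ)),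
            (∀ (g : ↥(HodgeCM.HermSpace3.adelicFin V)) (w : (datum413 hDel F V a₀ Φ i).omegaAt t),
                ψ ((datum413 hDel F V a₀ Φ i).rhoAt t g w) = rightRep F V g (ψ w)) →
              (∀ w, ψ w ∈ holCotForms (archFactorOf F V)) → ψ = 0) ∨
        (∀ ψ : (datum413 hDel F V a₀ Φ i).omegaAt t →ₗ[ℂ] ((adelicDatum F V).Adelic → (Fin 2 → ℂ)),
            (∀ (g : ↥(HodgeCM.HermSpace3.adelicFin V)) (w : (datum413 hDel F V a₀ Φ i).omegaAt t),
                ψ ((datum413 hDel F V a₀ Φ i).rhoAt t g w) = rightRep F V g (ψ w)) →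
              (∀ w, ψ w ∈ (holCotForms (archFactorOf F V)).map (conjFun F V)) → ψ = 0)

/-- **`stub_S1_hodgeMatsushimaDecAt`** — REGISTERED STUB S1 (M–L, B4 desk): the injective equivariant Matsushima–Hodge realisation of the pin's
`H¹_{B,τ'}(A_∞, ℂ)` by `(1,0) ⊕ (0,1)` cotangent automorphic forms (`StubS1HodgeMatsushimaDecAt`). HC_CM is proved only modulo the printed citations
until rung 0 closes. [cite: BorelWallach2000, VII 3.2, XIII 1.2] [cite: VoisinHodgeI2002, Cor. 7.6] [cite: Borel1997, §5.14] -/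
theorem stub_S1_hodgeMatsushimaDecAt : StubS1HodgeMatsushimaDecAt :=
  F0P3StubS1Dec.stubS1_holds   -- v1.3: CLOSED by ★ p792863 `Theorems/F0P3StubS1Dec.lean` (F0P3-p01 (g0), REF1 countersign 22:17:35Z); was `by sorry` in v1.2

/-- **`stub_S2_hodgeTypesDisjointStable`** — REGISTERED STUB S2 (S, carrier algebra): the two Hodge types of cotangent forms are disjoint and
stable under finite-adèlic right translation (`StubS2HodgeTypesDisjointStable`). [cite: Borel1997, §5.14] [cite: BorelWallach2000, VII 3.2] -/
theorem stub_S2_hodgeTypesDisjointStable : StubS2HodgeTypesDisjointStable :=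
  F0P3StubS2HodgeTypes.stubS2_holds   -- v1.2: CLOSED by ★ p791898 `Theorems/F0P3StubS2HodgeTypes.lean` (A-p09 (g18), REF1 countersign 21:55:45Z); was `by sorry` in v1.1

/-- **`stub_S3_holLineAt`** — REGISTERED STUB S3 (L; E1′ (1,0) ∘ J): the equivariant holomorphic-cotangent-valued maps out of `ω_V(t)` lie on a line
(`StubS3HolLineAt`). [cite: Rogawski1990, Thm. 14.6.4, §15.3] [cite: Marshall2014, §4.1] [cite: Liu2021, proof of Prop. 4.13, l. 2145] -/
theorem stub_S3_holLineAt : StubS3HolLineAt := by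
  sorry   -- v1.4: DISCHARGED MODULO LETTERS {E1, E1′h, (D)h, (E)h} by ★ p794332 `F0P3StubS3S4Holds.stubS3_holds hE1 hE1'h hDh hEh` (F0P3-p03 (g0); token identity 5a319f3c, REF1 23:01:39Z) — a hypothesis-free placeholder cannot be closed outright

/-- **`stub_S4_antiholLineAt`** — REGISTERED STUB S4 (L; E1′ (0,1) ∘ J): the equivariant anti-holomorphic-cotangent-valued maps out of `ω_V(t)` lie on
a line (`StubS4AntiholLineAt`). [cite: Rogawski1990, Thm. 14.6.4, §15.3] [cite: Marshall2014, §4.1] [cite: Liu2021, proof of Prop. 4.13, l. 2145] -/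
theorem stub_S4_antiholLineAt : StubS4AntiholLineAt := by
  sorry   -- v1.4: DISCHARGED MODULO LETTERS {E1, E1′a, (D)a, (E)a} by ★ p794332 `F0P3StubS3S4Holds.stubS4_holds hE1 hE1'a hDa hEa` (F0P3-p03 (g0); token identity 5575e2c8, REF1 23:01:39Z)

/-- **`stub_S5_hodgeTypeExclusionAt`** — REGISTERED STUB S5 (M; E2′ ∘ J, sign-free): `ω_V(t)` does not occur with both Hodge types
(`StubS5HodgeTypeExclusionAt`). [cite: Rogawski1990, §12.3, Thm. 13.3.5, Thm. 13.3.7] [cite: Marshall2014, §3.3] [cite: Liu2021, Lem. D.2 (2)] -/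
theorem stub_S5_hodgeTypeExclusionAt : StubS5HodgeTypeExclusionAt := by
  sorry   -- v1.4: DISCHARGED MODULO LETTERS {E2′, (D)h, (D)a} by ★ p793408 `F0P3StubS5Fold.stubS5_holds hE2' hDh hDa` (F0P3-p02 (g0); token identity cec04593, REF1 22:29:43Z)

/-! ## §3 Kernel-checked composition (no proof hole below this line) -/

section Assembly

universe u

variable {k : Type*} [Field k] {G : Type*} [Monoid G]
variable {W H X : Type u} [AddCommGroup W] [Module k W] [AddCommGroup H] [Module k H] [AddCommGroup X] [Module k X]

/-- Uniqueness of the decomposition along a disjoint pair of submodules (left component). [folklore] -/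
theorem left_eq_of_add_eq_add_of_disjoint {A B : Submodule k X} (hAB : Disjoint A B) {a a' b b' : X}
    (ha : a ∈ A) (ha' : a' ∈ A) (hb : b ∈ B) (hb' : b' ∈ B) (h : a + b = a' + b') : a = a' := by
  have h1 : a - a' ∈ A := A.sub_mem ha ha'
  have h2 : a - a' ∈ B := by
    have hab : a - a' = b' - b := by
      rw [sub_eq_sub_iff_add_eq_add]
      exact h.trans (add_comm _ _)
    rw [hab]
    exact B.sub_mem hb' hb
  exact sub_eq_zero.mp ((Submodule.disjoint_def.mp hAB) _ h1 h2)

/-- Uniqueness of the decomposition along a disjoint pair of submodules (right component). [folklore] -/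
theorem right_eq_of_add_eq_add_of_disjoint {A B : Submodule k X} (hAB : Disjoint A B) {a a' b b' : X}
    (ha : a ∈ A) (ha' : a' ∈ A) (hb : b ∈ B) (hb' : b' ∈ B) (h : a + b = a' + b') : b = b' :=
  left_eq_of_add_eq_add_of_disjoint hAB.symm hb hb' ha ha' ((add_comm b a).trans (h.trans (add_comm a' b')))

/-- **The algebra of the assembly** (generic): if `H` embeds `G`-equivariantly into `A ⊔ B ⊆ X` with `A`, `B` disjoint and `G`-stable
(S1, S2), the equivariant `A`-valued (resp. `B`-valued) linear maps out of `W` lie on a line (S3, S4), and one of the two families vanishes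
(S5), then `rank_k Hom_G(W, H) ≤ 1`.  Proof: post-composition with the embedding is an injective linear map on intertwiners; its values split
uniquely into equivariant `A`- and `B`-components (projection along the disjoint stable pair); one component is zero, the other lies on the
given line; an injective linear map into a line has source of rank `≤ 1`. [folklore] -/
theorem rank_intertwiningMap_le_one_of_split
    (ρ : Representation k G W) (σ : Representation k G H) (R : Representation k G X) (A B : Submodule k X)
    (hS1 : ∃ dec : H →ₗ[k] X, Function.Injective dec ∧ (∀ x, dec x ∈ A ⊔ B) ∧ ∀ g x, dec (σ g x) = R g (dec x))
    (hS2 : Disjoint A B ∧ (∀ (g : G) (x : X), x ∈ A → R g x ∈ A) ∧ (∀ (g : G) (x : X), x ∈ B → R g x ∈ B))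
    (hS3 : ∃ ψ₀ : W →ₗ[k] X, ∀ ψ : W →ₗ[k] X,
      (∀ g w, ψ (ρ g w) = R g (ψ w)) → (∀ w, ψ w ∈ A) → ∃ r : k, ψ = r • ψ₀)
    (hS4 : ∃ ψ₀ : W →ₗ[k] X, ∀ ψ : W →ₗ[k] X,
      (∀ g w, ψ (ρ g w) = R g (ψ w)) → (∀ w, ψ w ∈ B) → ∃ r : k, ψ = r • ψ₀)
    (hS5 : (∀ ψ : W →ₗ[k] X, (∀ g w, ψ (ρ g w) = R g (ψ w)) → (∀ w, ψ w ∈ A) → ψ = 0) ∨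
      (∀ ψ : W →ₗ[k] X, (∀ g w, ψ (ρ g w) = R g (ψ w)) → (∀ w, ψ w ∈ B) → ψ = 0)) :
    Module.rank k (Representation.IntertwiningMap ρ σ) ≤ 1 := by
  obtain ⟨dec, hinj, hmem, heqv⟩ := hS1
  obtain ⟨hAB, hA, hB⟩ := hS2
  -- the sum map `A × B → X` is injective with range `A ⊔ B`
  let cop : (↥A × ↥B) →ₗ[k] X := A.subtype.coprod B.subtype
  have hcop_apply : ∀ p : ↥A × ↥B, cop p = (p.1 : X) + (p.2 : X) := fun p => by
    simp only [cop, LinearMap.coprod_apply, Submodule.subtype_apply]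
  have hcop_inj : Function.Injective cop := by
    rw [← LinearMap.ker_eq_bot, LinearMap.ker_eq_bot']
    rintro ⟨a, b⟩ hab
    rw [hcop_apply] at hab
    have hab' : (a : X) + b = 0 + 0 := by simpa using hab
    have ha0 : (a : X) = 0 := left_eq_of_add_eq_add_of_disjoint hAB a.2 A.zero_mem b.2 B.zero_mem hab'
    have hb0 : (b : X) = 0 := right_eq_of_add_eq_add_of_disjoint hAB a.2 A.zero_mem b.2 B.zero_mem hab'
    ext
    · simpa using ha0
    · simpa using hb0
  have hrange : LinearMap.range cop = A ⊔ B := by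
    simp only [cop, LinearMap.range_coprod, Submodule.range_subtype]
  let e : (↥A × ↥B) ≃ₗ[k] ↥(LinearMap.range cop) := LinearEquiv.ofInjective cop hcop_inj
  -- post-composition with `dec`, linear in the intertwiner
  let Φ : Representation.IntertwiningMap ρ σ →ₗ[k] (W →ₗ[k] X) :=
    (LinearMap.llcomp k W H X dec) ∘ₗ Representation.IntertwiningMap.toLinearMapl ρ σ
  have hΦapply : ∀ (φ : Representation.IntertwiningMap ρ σ) (w : W), Φ φ w = dec (φ w) := fun φ w => rfl
  have hΦinj : Function.Injective Φ := by
    intro φ φ' h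
    apply Representation.IntertwiningMap.ext
    ext w
    apply hinj
    have := LinearMap.congr_fun h w
    simpa [hΦapply] using this
  have hΦeqv : ∀ (φ : Representation.IntertwiningMap ρ σ) (g : G) (w : W), Φ φ (ρ g w) = R g (Φ φ w) := by
    intro φ g w
    rw [hΦapply, hΦapply, Representation.IntertwiningMap.isIntertwining ρ σ φ g w]
    exact heqv g (φ w)
  have hval : ∀ (φ : Representation.IntertwiningMap ρ σ) (w : W), Φ φ w ∈ LinearMap.range cop := by
    intro φ w
    rw [hrange]
    exact hmem _
  -- the two components of `Φ φ` along `A ⊔ B = A ⊕ B`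
  let comp : Representation.IntertwiningMap ρ σ → (W →ₗ[k] (↥A × ↥B)) := fun φ =>
    (e.symm : ↥(LinearMap.range cop) →ₗ[k] (↥A × ↥B)) ∘ₗ LinearMap.codRestrict (LinearMap.range cop) (Φ φ) (hval φ)
  let ψA : Representation.IntertwiningMap ρ σ → (W →ₗ[k] X) := fun φ => A.subtype ∘ₗ LinearMap.fst k ↥A ↥B ∘ₗ comp φ
  let ψB : Representation.IntertwiningMap ρ σ → (W →ₗ[k] X) := fun φ => B.subtype ∘ₗ LinearMap.snd k ↥A ↥B ∘ₗ comp φ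
  have hmemA : ∀ φ w, ψA φ w ∈ A := fun φ w => ((comp φ w).1).2
  have hmemB : ∀ φ w, ψB φ w ∈ B := fun φ w => ((comp φ w).2).2
  have hsum : ∀ φ w, ψA φ w + ψB φ w = Φ φ w := by
    intro φ w
    have h1 : cop (comp φ w) = Φ φ w := by
      have h2 := congrArg Subtype.val (e.apply_symm_apply (LinearMap.codRestrict (LinearMap.range cop) (Φ φ) (hval φ) w))
      rw [LinearEquiv.ofInjective_apply] at h2
      exact h2
    calc ψA φ w + ψB φ w = ((comp φ w).1 : X) + ((comp φ w).2 : X) := rfl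
      _ = cop (comp φ w) := (hcop_apply _).symm
      _ = Φ φ w := h1
  have heqvA : ∀ φ g w, ψA φ (ρ g w) = R g (ψA φ w) := by
    intro φ g w
    have h := hsum φ (ρ g w)
    rw [hΦeqv, ← hsum φ w, map_add] at h
    exact left_eq_of_add_eq_add_of_disjoint hAB (hmemA φ _) (hA g _ (hmemA φ w)) (hmemB φ _) (hB g _ (hmemB φ w)) h
  have heqvB : ∀ φ g w, ψB φ (ρ g w) = R g (ψB φ w) := by
    intro φ g w
    have h := hsum φ (ρ g w)
    rw [hΦeqv, ← hsum φ w, map_add] at h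
    exact right_eq_of_add_eq_add_of_disjoint hAB (hmemA φ _) (hA g _ (hmemA φ w)) (hmemB φ _) (hB g _ (hmemB φ w)) h
  -- the rank bound from a line containing the range of the injective `Φ`
  have key : ∀ ψ₀ : W →ₗ[k] X, (∀ φ, Φ φ ∈ k ∙ ψ₀) → Module.rank k (Representation.IntertwiningMap ρ σ) ≤ 1 := by
    intro ψ₀ hline
    have hcod : Function.Injective (LinearMap.codRestrict (k ∙ ψ₀) Φ hline) := by
      intro φ φ' h
      exact hΦinj (by simpa using congrArg Subtype.val h)
    refine (LinearMap.rank_le_of_injective _ hcod).trans ?_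
    refine (rank_span_le _).trans ?_
    simp
  rcases hS5 with h5 | h5
  · obtain ⟨ψ₀, hψ₀⟩ := hS4
    refine key ψ₀ fun φ => ?_
    have hA0 : ψA φ = 0 := h5 (ψA φ) (heqvA φ) (hmemA φ)
    obtain ⟨r, hr⟩ := hψ₀ (ψB φ) (heqvB φ) (hmemB φ)
    have hΦφ : Φ φ = ψB φ := by
      ext w
      rw [← hsum φ w, hA0, LinearMap.zero_apply, zero_add]
    rw [hΦφ, hr]
    exact Submodule.mem_span_singleton.mpr ⟨r, rfl⟩
  · obtain ⟨ψ₀, hψ₀⟩ := hS3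
    refine key ψ₀ fun φ => ?_
    have hB0 : ψB φ = 0 := h5 (ψB φ) (heqvB φ) (hmemB φ)
    obtain ⟨r, hr⟩ := hψ₀ (ψA φ) (heqvA φ) (hmemA φ)
    have hΦφ : Φ φ = ψA φ := by
      ext w
      rw [← hsum φ w, hB0, LinearMap.zero_apply, add_zero]
    rw [hΦφ, hr]
    exact Submodule.mem_span_singleton.mpr ⟨r, rfl⟩

end Assembly

set_option synthInstance.maxHeartbeats 400000 in
set_option maxHeartbeats 8000000 in
/-- **HEAD 1 — the `_holds` composition: `hJ3a` from the five stubs** (kernel-checked): `S1 → S2 → S3 → S4 → S5 → HJ3aType`.  Unfold `HJ3aType` to the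
face and the triple (`datum413` is the pin's datum by `rfl`, `cohForms 𝔞₀ = holCotForms 𝔞₀ ⊔ conj(holCotForms 𝔞₀)` by definition) and apply
`rank_intertwiningMap_le_one_of_split` at `ρ = ω_V(t)`, `σ = H¹_{B,τ'}`, `R = rightRep F V`, `A = holCotForms 𝔞₀`, `B = conj A`.
HC_CM is proved only modulo the printed citations until rung 0 closes. [cite: Liu2021, proof of Prop. 4.13, l. 2121–2146] [cite: Rogawski1990, Thm. 14.6.4, §15.3] -/
theorem multiplicity_le_one_printed_holds_of (h1 : StubS1HodgeMatsushimaDecAt) (h2 : StubS2HodgeTypesDisjointStable) (h3 : StubS3HolLineAt)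
    (h4 : StubS4AntiholLineAt) (h5 : StubS5HodgeTypeExclusionAt) : HJ3aType := by
  intro hDel F _ h6 ι₁ V a₀ Φ hΦ i hn τ' t
  exact rank_intertwiningMap_le_one_of_split ((datum413 hDel F V a₀ Φ i).rhoAt t) ((datum413 hDel F V a₀ Φ i).rhoB τ') (rightRep F V)
    (holCotForms (archFactorOf F V)) ((holCotForms (archFactorOf F V)).map (conjFun F V))
    (h1 hDel F h6 V a₀ Φ hΦ i hn τ') (h2 F V) (h3 hDel F h6 V a₀ Φ hΦ i hn t) (h4 hDel F h6 V a₀ Φ hΦ i hn t) (h5 hDel F h6 V a₀ Φ hΦ i hn t)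

set_option synthInstance.maxHeartbeats 400000 in
set_option maxHeartbeats 8000000 in
/-- **`hJ3a` MODULO EXACTLY THE FIVE P3 STUBS** (zero further hypotheses): HEAD 1 applied to the registered stubs — the by-name fold
`stub_multiplicity_le_one_printed := hJ3a_of_stubs` of `Cruxes/H413/Lines/a3_liu413.lean` once the five stubs are theorems.
HC_CM is proved only modulo the printed citations until rung 0 closes. [cite: Liu2021, proof of Prop. 4.13, l. 2145] -/
theorem hJ3a_of_stubs : HJ3aType :=
  multiplicity_le_one_printed_holds_of stub_S1_hodgeMatsushimaDecAt stub_S2_hodgeTypesDisjointStable stub_S3_holLineAt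
    stub_S4_antiholLineAt stub_S5_hodgeTypeExclusionAt

set_option synthInstance.maxHeartbeats 400000 in
set_option maxHeartbeats 8000000 in
/-- AUDIT (kernel, same-statement box): the registry's stub for row III-2 (a)′ has EXACTLY the floor binder type `HdictEType` (V7 ll. 71–75). -/
example : HdictEType :=
  Summit.HodgeConjecture.CorCM.Lines.A3Liu413.stub_oscillatorTriple_dictionaryExistence

set_option synthInstance.maxHeartbeats 400000 in
set_option maxHeartbeats 8000000 in
/-- AUDIT (kernel, same-statement box): the registry's stub for row III-2 (c)′ has EXACTLY the floor binder type `HoccType` (V7 ll. 81–85). -/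
example : HoccType :=
  Summit.HodgeConjecture.CorCM.Lines.A3Liu413.stub_admissible_occursInH1

set_option synthInstance.maxHeartbeats 400000 in
set_option maxHeartbeats 8000000 in
/-- AUDIT (kernel, same-statement box): the registry's stub for row III-J3a — the one THIS line retires — has EXACTLY the type `HJ3aType` (V7 ll. 76–80),
so the by-name fold `stub_multiplicity_le_one_printed := hJ3a_of_stubs` typechecks. -/
example : HJ3aType :=
  Summit.HodgeConjecture.CorCM.Lines.A3Liu413.stub_multiplicity_le_one_printed

set_option synthInstance.maxHeartbeats 400000 in
set_option maxHeartbeats 8000000 in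
/-- **HEAD 2 (head of record) — the crux `HCCMUnconditional.H413` BY NAME, ZERO hypotheses**: modulo EXACTLY the five P3 stubs (row III-J3a, through
`hJ3a_of_stubs`) and the two OTHER floor rows through their REGISTERED stubs of the crux's registry of record `Cruxes/H413/Lines/a3_liu413.lean` v10.2 —
`stub_oscillatorTriple_dictionaryExistence` (III-2 (a)′, programme P2's target) and `stub_admissible_occursInH1` (III-2 (c)′, programme P4's target) — fed to
A-p07's closing theorem ★ `Hyp413Closing.H413_of_three_facts_flat (hdictE) (hJ3a) (hocc)` (`Theorems/HCCMUnconditionalH413OfFacts.lean` :267).  No duplicate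
obligations are declared; when P2 ∕ P4 close their lines the registry's two stubs become theorems by name and this head needs no change.
HC_CM is proved only modulo the printed citations until rung 0 closes. [cite: Liu2021, Prop. 4.13; Rem. 4.14] [cite: Rogawski1990, Thm. 14.6.4; §15.3] -/
theorem H413_of_P3 : Summit.HodgeConjecture.HodgeConjecture.Theses.HCCMUnconditional.H413 :=
  Summit.HodgeConjecture.CorCM.Hyp413Closing.H413_of_three_facts_flat
    Summit.HodgeConjecture.CorCM.Lines.A3Liu413.stub_oscillatorTriple_dictionaryExistence hJ3a_of_stubs
    Summit.HodgeConjecture.CorCM.Lines.A3Liu413.stub_admissible_occursInH1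

set_option synthInstance.maxHeartbeats 400000 in
set_option maxHeartbeats 8000000 in
/-- **HEAD 3 (v1.4) — ROW III-J3a MODULO EXACTLY THE EIGHT PRINTED-CITATION LETTERS, BY NAME**: `HJ3aType` (= floor V7 ll. 76–80, the binder
`hJ3a`) from E1, E1′h, E1′a, E2′, (D)h, (D)a, (E)h, (E)a and NOTHING ELSE — ★ p794926 `HJ3aOfLetters.hJ3a_of_letters` (F0P3-p02 (g0)), itself the
composition ★ `F0P3HJ3aAssembly.hJ3a_of_S345` (F0P3-p01 (g0); this line's §3 ported Theorems-side) of ★ `F0P3StubS3S4Holds.stubS3_holds hE1 hE1'h hDh hEh`,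
★ `…stubS4_holds hE1 hE1'a hDa hEa` (F0P3-p03 (g0)) and ★ `F0P3StubS5Fold.stubS5_holds hE2' hDh hDa` (F0P3-p02 (g0)), with S1 ★ `F0P3StubS1Dec.stubS1_holds`
and S2 ★ `F0P3StubS2HodgeTypes.stubS2_holds` inside; continuity `hcont` ★ `CohFormsL2.continuous_apply_of_mem_cohForms` (F0P2-p01), junction ★
`H413SpectrumJunction*`∕`H413SpectrumOrthogonality`∕`H413SpectrumPartsPin` (F0P3-p04 (g0)), Schur line ★ `F0P3SchurLine*` (F0P3-p03 (g0)).  REF1 kernel cert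
2026-08-30T22:47:11Z ∕ 23:2xZ: conclusion token-identical to `HJ3aType`, `#print axioms` = [propext, Classical.choice, Quot.sound].  This is programme P3's
floor-0 deliverable: floor V8 may re-type row III-J3a from the in-house binder `hJ3a` to the eight letter binders through this theorem.
HC_CM is proved only modulo the printed citations until rung 0 closes. [cite: Rogawski1990, Thm. 14.6.4, §15.3; Thm. 13.1.1; §12.3]
[cite: BorelWallach2000, Ch. VI; Ch. VII 2.10] [cite: BorelJacquet1979, §4.6] [cite: Liu2021, proof of Prop. 4.13, l. 2121–2146] -/
theorem hJ3a_of_letters (hE1 : Literature.NumberTheory.Rogawski1990.innerFormMultiplicityLeOne)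
    (hE1'h : Literature.NumberTheory.Rogawski1990.cohFinComponentUnique_hol)
    (hE1'a : Literature.NumberTheory.Rogawski1990.cohFinComponentUnique_antihol)
    (hE2' : Literature.NumberTheory.Rogawski1990.hodgeTypeRigid)
    (hDh : Literature.NumberTheory.Automorphic.UnitaryGroup.CotangentForms.holCotFormSpectralProjection)
    (hDa : Literature.NumberTheory.Automorphic.UnitaryGroup.CotangentForms.antiholCotFormSpectralProjection)
    (hEh : Literature.NumberTheory.Automorphic.UnitaryGroup.CotangentForms.cohIsotypicLine_hol)
    (hEa : Literature.NumberTheory.Automorphic.UnitaryGroup.CotangentForms.cohIsotypicLine_antihol) : HJ3aType :=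
  HJ3aOfLetters.hJ3a_of_letters hE1 hE1'h hE1'a hE2' hDh hDa hEh hEa

set_option synthInstance.maxHeartbeats 400000 in
set_option maxHeartbeats 8000000 in
/-- **HEAD 4 (v1.4) — the crux `HCCMUnconditional.H413` BY NAME from the EIGHT LETTERS**, the two OTHER floor rows entering through their REGISTERED
stubs of the registry of record `Cruxes/H413/Lines/a3_liu413.lean` v10.2 (`stub_oscillatorTriple_dictionaryExistence` = III-2 (a)′, programme P2;
`stub_admissible_occursInH1` = III-2 (c)′, programme P4), via A-p07's ★ `Hyp413Closing.H413_of_three_facts_flat`.  Its `sorryAx` comes ONLY from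
those two stubs (P2∕P4 business), none from P3.  (★ `HJ3aOfLetters.H413_of_letters` is the same head with the two rows as explicit hypotheses.)
HC_CM is proved only modulo the printed citations until rung 0 closes. [cite: Liu2021, Prop. 4.13; Rem. 4.14] [cite: Rogawski1990, Thm. 14.6.4; §15.3] -/
theorem H413_of_letters (hE1 : Literature.NumberTheory.Rogawski1990.innerFormMultiplicityLeOne)
    (hE1'h : Literature.NumberTheory.Rogawski1990.cohFinComponentUnique_hol)
    (hE1'a : Literature.NumberTheory.Rogawski1990.cohFinComponentUnique_antihol)
    (hE2' : Literature.NumberTheory.Rogawski1990.hodgeTypeRigid)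
    (hDh : Literature.NumberTheory.Automorphic.UnitaryGroup.CotangentForms.holCotFormSpectralProjection)
    (hDa : Literature.NumberTheory.Automorphic.UnitaryGroup.CotangentForms.antiholCotFormSpectralProjection)
    (hEh : Literature.NumberTheory.Automorphic.UnitaryGroup.CotangentForms.cohIsotypicLine_hol)
    (hEa : Literature.NumberTheory.Automorphic.UnitaryGroup.CotangentForms.cohIsotypicLine_antihol) :
    Summit.HodgeConjecture.HodgeConjecture.Theses.HCCMUnconditional.H413 :=
  Summit.HodgeConjecture.CorCM.Hyp413Closing.H413_of_three_facts_flat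
    Summit.HodgeConjecture.CorCM.Lines.A3Liu413.stub_oscillatorTriple_dictionaryExistence (hJ3a_of_letters hE1 hE1'h hE1'a hE2' hDh hDa hEh hEa)
    Summit.HodgeConjecture.CorCM.Lines.A3Liu413.stub_admissible_occursInH1

set_option synthInstance.maxHeartbeats 400000 in
set_option maxHeartbeats 8000000 in
/-- AUDIT (kernel, same-statement box, v1.4): ★ `HJ3aOfLetters.H413_of_letters`'s two row hypotheses have EXACTLY the floor binder types `HdictEType` ∕
`HoccType` — the Theorems-side head and HEAD 4 agree by δ. -/
example (hE1 : Literature.NumberTheory.Rogawski1990.innerFormMultiplicityLeOne)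
    (hE1'h : Literature.NumberTheory.Rogawski1990.cohFinComponentUnique_hol)
    (hE1'a : Literature.NumberTheory.Rogawski1990.cohFinComponentUnique_antihol)
    (hE2' : Literature.NumberTheory.Rogawski1990.hodgeTypeRigid)
    (hDh : Literature.NumberTheory.Automorphic.UnitaryGroup.CotangentForms.holCotFormSpectralProjection)
    (hDa : Literature.NumberTheory.Automorphic.UnitaryGroup.CotangentForms.antiholCotFormSpectralProjection)
    (hEh : Literature.NumberTheory.Automorphic.UnitaryGroup.CotangentForms.cohIsotypicLine_hol)
    (hEa : Literature.NumberTheory.Automorphic.UnitaryGroup.CotangentForms.cohIsotypicLine_antihol)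
    (hdictE : HdictEType) (hocc : HoccType) : Summit.HodgeConjecture.HodgeConjecture.Theses.HCCMUnconditional.H413 :=
  HJ3aOfLetters.H413_of_letters hE1 hE1'h hE1'a hE2' hDh hDa hEh hEa hdictE hocc

set_option synthInstance.maxHeartbeats 400000 in
set_option maxHeartbeats 8000000 in
/-- **HEAD 3′ (v1.4) — ROW III-J3a MODULO FIVE LETTERS {E1, E1′h, E2′, (D)h, (E)h}**: the three (0,1)-type letters are corollaries of their (1,0) twins by
the conjugation symmetry `P ↦ P̄` — ★ p794879 `CotangentForms.antiholCotFormSpectralProjection_of_hol`, ★ p795136 `CotangentForms.cohFinComponentUnique_antihol_of_hol`,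
`CotangentForms.cohIsotypicLine_antihol_of_hol` (F0P2-p01 (g2)).  HC_CM is proved only modulo the printed citations until rung 0 closes.
[cite: Rogawski1990, Thm. 14.6.4, §15.3; Thm. 13.1.1] [cite: BorelWallach2000, Ch. VI] [cite: BorelJacquet1979, §4.6] -/
theorem hJ3a_of_five_letters (hE1 : Literature.NumberTheory.Rogawski1990.innerFormMultiplicityLeOne)
    (hE1'h : Literature.NumberTheory.Rogawski1990.cohFinComponentUnique_hol)
    (hE2' : Literature.NumberTheory.Rogawski1990.hodgeTypeRigid)
    (hDh : Literature.NumberTheory.Automorphic.UnitaryGroup.CotangentForms.holCotFormSpectralProjection)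
    (hEh : Literature.NumberTheory.Automorphic.UnitaryGroup.CotangentForms.cohIsotypicLine_hol) : HJ3aType :=
  hJ3a_of_letters hE1 hE1'h (Literature.NumberTheory.Automorphic.UnitaryGroup.CotangentForms.cohFinComponentUnique_antihol_of_hol hE1'h) hE2' hDh
    (Literature.NumberTheory.Automorphic.UnitaryGroup.CotangentForms.antiholCotFormSpectralProjection_of_hol hDh) hEh
    (Literature.NumberTheory.Automorphic.UnitaryGroup.CotangentForms.cohIsotypicLine_antihol_of_hol hEh)

set_option synthInstance.maxHeartbeats 400000 in
set_option maxHeartbeats 8000000 in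
/-- **HEAD 4′ (v1.4) — the crux `HCCMUnconditional.H413` BY NAME from the FIVE LETTERS** (the two other rows through the registry's stubs, as in HEAD 4).
HC_CM is proved only modulo the printed citations until rung 0 closes. [cite: Liu2021, Prop. 4.13; Rem. 4.14] [cite: Rogawski1990, Thm. 14.6.4; §15.3] -/
theorem H413_of_five_letters (hE1 : Literature.NumberTheory.Rogawski1990.innerFormMultiplicityLeOne)
    (hE1'h : Literature.NumberTheory.Rogawski1990.cohFinComponentUnique_hol)
    (hE2' : Literature.NumberTheory.Rogawski1990.hodgeTypeRigid)
    (hDh : Literature.NumberTheory.Automorphic.UnitaryGroup.CotangentForms.holCotFormSpectralProjection)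
    (hEh : Literature.NumberTheory.Automorphic.UnitaryGroup.CotangentForms.cohIsotypicLine_hol) :
    Summit.HodgeConjecture.HodgeConjecture.Theses.HCCMUnconditional.H413 :=
  Summit.HodgeConjecture.CorCM.Hyp413Closing.H413_of_three_facts_flat
    Summit.HodgeConjecture.CorCM.Lines.A3Liu413.stub_oscillatorTriple_dictionaryExistence (hJ3a_of_five_letters hE1 hE1'h hE2' hDh hEh)
    Summit.HodgeConjecture.CorCM.Lines.A3Liu413.stub_admissible_occursInH1

end Summit.HodgeConjecture.HodgeConjecture.Cruxes.H413.F0U3CohMultOne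

end
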